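import Summits.Ventures.PercRepro.C026GoodDegreeBridge

/-!
# The Bad-count bridges and the monotone structure of `Good` (p6, gen 20)

Setting of `C026GoodDegreeBridge`: skeleton `(G; a, b, c)`, red = `S`, blue = `Sᶜ`; `(D,A)` sources;
`Good_t(S)` = the other live vertex is red-reachable from `c` by a walk avoiding the blue cluster of
`t`; `Bad` = neither `Good_a` nor `Good_b`.  Two clean sufficient statements of the censuses
(proofs/P6-E00-ACCOUNTING.md §2), both tight on the hub, are turned into kernel bridges:

* `(β1′)` `#Bad ≤ #Good_a + #Good_b` ⟹ `n(D,A) ≤ 2|B|` ⟹ `(E00)` ⟹ THEOREM L2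
  (`pFun_threeCells_nonneg_of_bad_le_good`) — the count behind mine-3's full up-set Hall condition;
* `(β1)` `#Bad ≤ |B|` ⟹ `n(D,A) ≤ 2|B|` ⟹ `(E00)` ⟹ THEOREM L2 (`pFun_threeCells_nonneg_of_bad_le`)
  — «one injective rule `Bad → B`» (mine-3 §38).

Both rest on `n(D,A) = #Good + #Bad` with `#Good ≤ #Good_a + #Good_b ≤ |B|` (STAGE 2).  The file also
records the order structure used by the flow certificates: `(D,A)` is an up-set of the configuration
lattice (`DA_mono`), `Good_t` is up-closed (`walkAvoiding_cluster_compl_mono`: opening edges keeps every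
red walk and shrinks every blue cluster), hence `Bad` is down-closed inside `(D,A)`.
-/

namespace PercRepro

namespace MultiGraph

open Finset

variable {V E : Type*} {G : MultiGraph V E}

/-- **`(D,A)` is an up-set**: opening edges keeps the red connections and destroys blue ones. -/
theorem DA_mono {S T : Config E} (hST : S ≤ T) {a b c : V}
    (h : (G.Conn S c a ∧ G.Conn S c b) ∧ (¬ G.Conn Sᶜ c a ∧ ¬ G.Conn Sᶜ c b ∧ ¬ G.Conn Sᶜ a b)) :
    (G.Conn T c a ∧ G.Conn T c b) ∧ (¬ G.Conn Tᶜ c a ∧ ¬ G.Conn Tᶜ c b ∧ ¬ G.Conn Tᶜ a b) := by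
  have hc : Tᶜ ≤ Sᶜ := compl_le_compl hST
  exact ⟨⟨h.1.1.mono hST, h.1.2.mono hST⟩, fun h1 => h.2.1 (h1.mono hc),
    fun h2 => h.2.2.1 (h2.mono hc), fun h3 => h.2.2.2 (h3.mono hc)⟩

/-- **`Good_t` is up-closed**: a red walk from `c` to `j` avoiding the blue cluster of `t` in `S` is a
red walk in any `T ≥ S` avoiding the (smaller) blue cluster of `t` in `T`. -/
theorem walkAvoiding_cluster_compl_mono {S T : Config E} (hST : S ≤ T) {t c j : V}
    (h : G.WalkAvoiding S (G.cluster Sᶜ t) c j) : G.WalkAvoiding T (G.cluster Tᶜ t) c j := by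
  have hc : G.cluster Tᶜ t ⊆ G.cluster Sᶜ t := G.cluster_mono (compl_le_compl hST) t
  refine ⟨fun hm => h.1 (hc hm), ?_⟩
  exact reflTransGen_of_imp (fun _ _ hxy => ⟨hxy.1.mono hST, fun hm => hxy.2 (hc hm)⟩) h.2

section Count

variable [Fintype V] [DecidableEq V] [Fintype E] [DecidableEq E]

omit [Fintype V] [DecidableEq V] in
open Classical in
/-- `n(D,A) = #Good + #Bad` (`Good = Good_a ∪ Good_b`). -/
theorem card_DA_eq_good_add_bad (a b c : V) :
    (univ.filter fun S : Config E => (G.Conn S c a ∧ G.Conn S c b) ∧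
        (¬ G.Conn Sᶜ c a ∧ ¬ G.Conn Sᶜ c b ∧ ¬ G.Conn Sᶜ a b)).card =
      (univ.filter fun S : Config E => ((G.Conn S c a ∧ G.Conn S c b) ∧
        (¬ G.Conn Sᶜ c a ∧ ¬ G.Conn Sᶜ c b ∧ ¬ G.Conn Sᶜ a b)) ∧
        (G.WalkAvoiding S (G.cluster Sᶜ a) c b ∨ G.WalkAvoiding S (G.cluster Sᶜ b) c a)).card +
      (univ.filter fun S : Config E => ((G.Conn S c a ∧ G.Conn S c b) ∧
        (¬ G.Conn Sᶜ c a ∧ ¬ G.Conn Sᶜ c b ∧ ¬ G.Conn Sᶜ a b)) ∧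
        ¬ (G.WalkAvoiding S (G.cluster Sᶜ a) c b ∨ G.WalkAvoiding S (G.cluster Sᶜ b) c a)).card := by
  rw [← Finset.card_filter_add_card_filter_not
    (s := univ.filter fun S : Config E => (G.Conn S c a ∧ G.Conn S c b) ∧
      (¬ G.Conn Sᶜ c a ∧ ¬ G.Conn Sᶜ c b ∧ ¬ G.Conn Sᶜ a b))
    (fun S : Config E => G.WalkAvoiding S (G.cluster Sᶜ a) c b ∨
      G.WalkAvoiding S (G.cluster Sᶜ b) c a)]
  rw [Finset.filter_filter, Finset.filter_filter]

omit [Fintype V] [DecidableEq V] in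
open Classical in
/-- `#Good ≤ #Good_a + #Good_b` (`Good = Good_a ∪ Good_b`). -/
theorem card_good_le_add (a b c : V) :
    (univ.filter fun S : Config E => ((G.Conn S c a ∧ G.Conn S c b) ∧
        (¬ G.Conn Sᶜ c a ∧ ¬ G.Conn Sᶜ c b ∧ ¬ G.Conn Sᶜ a b)) ∧
        (G.WalkAvoiding S (G.cluster Sᶜ a) c b ∨ G.WalkAvoiding S (G.cluster Sᶜ b) c a)).card ≤
      (univ.filter fun S : Config E => ((G.Conn S c a ∧ G.Conn S c b) ∧
        (¬ G.Conn Sᶜ c a ∧ ¬ G.Conn Sᶜ c b ∧ ¬ G.Conn Sᶜ a b)) ∧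
        G.WalkAvoiding S (G.cluster Sᶜ a) c b).card +
      (univ.filter fun S : Config E => ((G.Conn S c a ∧ G.Conn S c b) ∧
        (¬ G.Conn Sᶜ c a ∧ ¬ G.Conn Sᶜ c b ∧ ¬ G.Conn Sᶜ a b)) ∧
        G.WalkAvoiding S (G.cluster Sᶜ b) c a).card := by
  refine le_trans (Finset.card_le_card ?_) (Finset.card_union_le _ _)
  intro S hS
  simp only [mem_filter, mem_univ, true_and, mem_union] at hS ⊢
  rcases hS.2 with h | h
  · exact Or.inl ⟨hS.1, h⟩
  · exact Or.inr ⟨hS.1, h⟩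

open Classical in
/-- **`(β1′)` ⟹ `(E00)`**: if the Bad sources are at most the Good-degree total, `(E00)` holds. -/
theorem pFun_liveCells_nonneg_of_bad_le_good (a b c : V)
    (hB : (univ.filter fun S : Config E => ((G.Conn S c a ∧ G.Conn S c b) ∧
          (¬ G.Conn Sᶜ c a ∧ ¬ G.Conn Sᶜ c b ∧ ¬ G.Conn Sᶜ a b)) ∧
          ¬ (G.WalkAvoiding S (G.cluster Sᶜ a) c b ∨
            G.WalkAvoiding S (G.cluster Sᶜ b) c a)).card ≤
        (univ.filter fun S : Config E => ((G.Conn S c a ∧ G.Conn S c b) ∧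
          (¬ G.Conn Sᶜ c a ∧ ¬ G.Conn Sᶜ c b ∧ ¬ G.Conn Sᶜ a b)) ∧
          G.WalkAvoiding S (G.cluster Sᶜ a) c b).card +
        (univ.filter fun S : Config E => ((G.Conn S c a ∧ G.Conn S c b) ∧
          (¬ G.Conn Sᶜ c a ∧ ¬ G.Conn Sᶜ c b ∧ ¬ G.Conn Sᶜ a b)) ∧
          G.WalkAvoiding S (G.cluster Sᶜ b) c a).card) :
    0 ≤ G.pFun c (liveCells a b) (liveCells a b) univ := by
  apply pFun_liveCells_nonneg_of_two_mul
  have h1 := card_DA_eq_good_add_bad (G := G) a b c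
  have h2 := card_good_le_add (G := G) a b c
  have h3 := card_good_add_good_le (G := G) a b c
  omega

open Classical in
/-- **`(β1)` ⟹ `(E00)`**: if the Bad sources are at most the red-`B` configurations, `(E00)` holds. -/
theorem pFun_liveCells_nonneg_of_bad_le (a b c : V)
    (hB : (univ.filter fun S : Config E => ((G.Conn S c a ∧ G.Conn S c b) ∧
          (¬ G.Conn Sᶜ c a ∧ ¬ G.Conn Sᶜ c b ∧ ¬ G.Conn Sᶜ a b)) ∧
          ¬ (G.WalkAvoiding S (G.cluster Sᶜ a) c b ∨
            G.WalkAvoiding S (G.cluster Sᶜ b) c a)).card ≤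
        (univ.filter fun T : Config E =>
          (G.Conn T c a ∧ ¬ G.Conn T c b) ∨ (G.Conn T c b ∧ ¬ G.Conn T c a)).card) :
    0 ≤ G.pFun c (liveCells a b) (liveCells a b) univ := by
  apply pFun_liveCells_nonneg_of_two_mul
  have h1 := card_DA_eq_good_add_bad (G := G) a b c
  have h2 := card_good_le_add (G := G) a b c
  have h3 := card_good_add_good_le (G := G) a b c
  omega

open Classical in
/-- **`(β1′)` ⟹ THEOREM L2 (live probe)**. -/
theorem pFun_threeCells_nonneg_of_bad_le_good (a b c : V)
    (hB : (univ.filter fun S : Config E => ((G.Conn S c a ∧ G.Conn S c b) ∧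
          (¬ G.Conn Sᶜ c a ∧ ¬ G.Conn Sᶜ c b ∧ ¬ G.Conn Sᶜ a b)) ∧
          ¬ (G.WalkAvoiding S (G.cluster Sᶜ a) c b ∨
            G.WalkAvoiding S (G.cluster Sᶜ b) c a)).card ≤
        (univ.filter fun S : Config E => ((G.Conn S c a ∧ G.Conn S c b) ∧
          (¬ G.Conn Sᶜ c a ∧ ¬ G.Conn Sᶜ c b ∧ ¬ G.Conn Sᶜ a b)) ∧
          G.WalkAvoiding S (G.cluster Sᶜ a) c b).card +
        (univ.filter fun S : Config E => ((G.Conn S c a ∧ G.Conn S c b) ∧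
          (¬ G.Conn Sᶜ c a ∧ ¬ G.Conn Sᶜ c b ∧ ¬ G.Conn Sᶜ a b)) ∧
          G.WalkAvoiding S (G.cluster Sᶜ b) c a).card)
    {z κ x₁ K₁ x₂ K₂ : ℝ}
    (hz : 0 ≤ z ∧ z ≤ 1) (hκ : kMin z ≤ κ) (hx₁ : 0 ≤ x₁ ∧ x₁ ≤ 1) (hx₂ : 0 ≤ x₂ ∧ x₂ ≤ 1)
    (hK₁ : kMin x₁ ≤ K₁) (hK₂ : kMin x₂ ≤ K₂) :
    0 ≤ G.pFun c (threeCells c a b z x₁ x₂) (threeCells c a b κ K₁ K₂) univ :=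
  pFun_threeCells_nonneg_of_E00 c a b hz hκ hx₁ hx₂ hK₁ hK₂
    (pFun_liveCells_nonneg_of_bad_le_good a b c hB)

open Classical in
/-- **`(β1)` ⟹ THEOREM L2 (live probe)**. -/
theorem pFun_threeCells_nonneg_of_bad_le (a b c : V)
    (hB : (univ.filter fun S : Config E => ((G.Conn S c a ∧ G.Conn S c b) ∧
          (¬ G.Conn Sᶜ c a ∧ ¬ G.Conn Sᶜ c b ∧ ¬ G.Conn Sᶜ a b)) ∧
          ¬ (G.WalkAvoiding S (G.cluster Sᶜ a) c b ∨
            G.WalkAvoiding S (G.cluster Sᶜ b) c a)).card ≤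
        (univ.filter fun T : Config E =>
          (G.Conn T c a ∧ ¬ G.Conn T c b) ∨ (G.Conn T c b ∧ ¬ G.Conn T c a)).card)
    {z κ x₁ K₁ x₂ K₂ : ℝ}
    (hz : 0 ≤ z ∧ z ≤ 1) (hκ : kMin z ≤ κ) (hx₁ : 0 ≤ x₁ ∧ x₁ ≤ 1) (hx₂ : 0 ≤ x₂ ∧ x₂ ≤ 1)
    (hK₁ : kMin x₁ ≤ K₁) (hK₂ : kMin x₂ ≤ K₂) :
    0 ≤ G.pFun c (threeCells c a b z x₁ x₂) (threeCells c a b κ K₁ K₂) univ :=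
  pFun_threeCells_nonneg_of_E00 c a b hz hκ hx₁ hx₂ hK₁ hK₂
    (pFun_liveCells_nonneg_of_bad_le a b c hB)

end Count

end MultiGraph

end PercRepro
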